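import Literature.AlgebraicGeometry.Motives.StandardConjecturesDominatedVarieties
import Mathlib.LinearAlgebra.Projection
import HarnessLib

/-!
# `h(U)` is a direct summand of `h(V)` for `U` dominated by `V`

Let `W : WeilCohomology k K` be the tree's abstract Weil cohomology theory and `f : V ⟶ U` a
morphism of smooth projective varieties (`dim V = N = M + r`, `dim U = M`) with `f₊ ζ ≠ 0` for a
rational algebraic class `ζ ∈ Aʳ(V)_ℚ` (Kleiman 1968 Prop. 1.2.4; Kahn 2020 Lemma 6.30 (2)), so
that `f₊ ζ = q · 1` with `q ≠ 0` and `f₊ (f* x ∪ ζ) = q x` (projection formula). The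
cohomological content of "`h(U)` is a direct summand of `h(V)`" (Kahn 2020 §6.9, Lemma 6.30 (2):
"for every direct summand `M'` of `M`") is made explicit:

* `exists_algebraic_projector_onto_range_pullback`: there is a graded endomorphism `P` of `H•(V)`,
  **induced by algebraic correspondences**, concentrated on the diagonal, **idempotent**, with
  `P ∘ f* = f*` and **`Im Pᵢ = f* Hⁱ(U)`** — namely `P = f* ∘ B` for the algebraic retraction `B`
  of `f*` (`B ∘ f* = id`, `exists_algebraic_retraction_pullback_of_pushforward_ne_zero`,
  `B = q⁻¹ f₊ (· ∪ ζ)`); composites of algebraic correspondences are algebraic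
  (`isAlgebraicGradedOp_comp_holds`, Kleiman 1968 §1.3);
* `isCompl_range_pullback_ker_pushforward_cup`: the explicit decomposition
  **`Hⁱ(V) = f* Hⁱ(U) ⊕ Ker (x ↦ f₊ (x ∪ ζ))`** (the projector `q⁻¹ f* f₊ (· ∪ ζ)`), and its
  equidimensional case `isCompl_range_pullback_ker_pushforward`: **`Hⁱ(V) = f* Hⁱ(U) ⊕ Ker f₊`** for
  `f` of non-zero degree (`f₊ f* = deg f`, Kleiman 1968 Prop. 1.2.4; Kahn 2020 §3.5.1);
* `finrank_eq_finrank_add_finrank_ker_pushforward_cup`: `bᵢ(V) = bᵢ(U) + dim Ker (f₊ (· ∪ ζ))`.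

Theorems only (no definition, no named fact, no instance).

## References

* [Kahn2020] B. Kahn, *Zeta and L-functions of varieties and motives*, LMS Lecture Note Ser. 462
  (2020), §3.5.1 (projection formula), §6.9 Lemma 6.30 (2).
* [Kleiman1968AlgebraicCycles] S. Kleiman, *Algebraic cycles and the Weil conjectures*, in: Dix
  exposés sur la cohomologie des schémas (1968), §1.2 Prop. 1.2.4, §1.3.
-/

universe u v

open CategoryTheory AlgebraicGeometry

noncomputable section

namespace Literature.AlgebraicGeometry.Motives

namespace WeilCohomology

variable {k : Type u} [Field k] {K : Type v} [Field K] [CharZero K] (W : WeilCohomology k K)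
variable {N M r : ℕ} {V U : SchemeOver k}

/-- Composition with a degree-diagonal graded operator: `(S ∘ T)ᵢⱼ = Sᵢⱼ ∘ Tᵢᵢ` when `Tᵢₘ = 0`
for `m ≠ i` (the `finsum` over the middle degree has one term). [cite: Kleiman1968AlgebraicCycles, §1.4] -/
private theorem comp_apply_of_diagonal {X Y Z : SchemeOver k} (S : W.GradedOp Y Z)
    (T : W.GradedOp X Y) (hT : ∀ i m : ℕ, i ≠ m → T i m = 0) (i j : ℕ) :
    PreWeilCohomology.GradedOp.comp S T i j = (S i j).comp (T i i) := by
  have h := PreWeilCohomology.GradedOp.comp_apply_of_shift S T 0 (fun i m hm ↦ hT i m (by omega)) i j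
  simpa only [Nat.add_zero] using h

/-! ## The algebraic projector onto `f* H(U)` -/

/-- **`h(U)` is a direct summand of `h(V)` for `U` dominated by `V`** (cohomological form of
Kahn 2020 Lemma 6.30 (2) / Kleiman 1968 §1.3): if `f₊ ζ ≠ 0` for some `ζ ∈ Aʳ(V)_ℚ`, there is a
graded endomorphism `P` of `H•(V)` induced by algebraic correspondences with `ℚ`-coefficients,
concentrated on the diagonal, idempotent, restricting to the identity on `f* H•(U)` and with image
exactly `f* Hⁱ(U)` in each degree: `P = f* ∘ B` where `B` is the algebraic retraction of `f*`
(`B ∘ f* = id`, `exists_algebraic_retraction_pullback_of_pushforward_ne_zero`).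
[cite: Kahn2020, §6.9 Lemma 6.30 (2)] [cite: Kleiman1968AlgebraicCycles, §1.3] -/
theorem exists_algebraic_projector_onto_range_pullback (hV : IsSmoothProjective N V)
    (hU : IsSmoothProjective M U) (f : V ⟶ U) {ζ : W.obj V (2 * r)}
    (hζ : ζ ∈ W.ratAlgebraicClasses V r) {he : 2 * r + 2 * M = 2 * N} {hd : 0 + 2 * M = 2 * M}
    (hne : W.pushforward (N := N) hU f he hd ζ ≠ 0) :
    ∃ P : W.GradedOp V V, W.IsAlgebraicGradedOp N N P ∧ (∀ i j : ℕ, i ≠ j → P i j = 0) ∧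
      (∀ i : ℕ, P i i ∘ₗ P i i = P i i) ∧ (∀ i : ℕ, P i i ∘ₗ W.pullback f i = W.pullback f i) ∧
      ∀ i : ℕ, LinearMap.range (P i i) = LinearMap.range (W.pullback f i) := by
  obtain ⟨B, hBalg, hBd, hBA⟩ :=
    W.exists_algebraic_retraction_pullback_of_pushforward_ne_zero hV hU f hζ hne
  set A : W.GradedOp U V := fun a b ↦ PreWeilCohomology.GradedOp.ofLinearMap (W.pullback f a) a b
    with hA
  have hAalg : W.IsAlgebraicGradedOp M N A := W.isAlgebraicGradedOp_degreewise_pullback hV hU f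
  have hPij : ∀ i j : ℕ, PreWeilCohomology.GradedOp.comp A B i j = (A i j).comp (B i i) :=
    fun i j ↦ W.comp_apply_of_diagonal A B hBd i j
  have hPii : ∀ i : ℕ, PreWeilCohomology.GradedOp.comp A B i i = W.pullback f i ∘ₗ B i i := by
    intro i
    rw [hPij, hA, PreWeilCohomology.GradedOp.degreewise_apply_same]
  refine ⟨PreWeilCohomology.GradedOp.comp A B, W.isAlgebraicGradedOp_comp_holds hV hU hV hAalg hBalg,
    fun i j hij ↦ ?_, fun i ↦ ?_, fun i ↦ ?_, fun i ↦ ?_⟩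
  · rw [hPij, hA, PreWeilCohomology.GradedOp.degreewise_apply_of_ne _ hij, LinearMap.zero_comp]
  · rw [hPii, LinearMap.comp_assoc, ← LinearMap.comp_assoc (B i i) (W.pullback f i) (B i i), hBA i,
      LinearMap.id_comp]
  · rw [hPii, LinearMap.comp_assoc, hBA i, LinearMap.comp_id]
  · rw [hPii]
    refine le_antisymm (LinearMap.range_comp_le_range _ _) ?_
    rintro _ ⟨x, rfl⟩
    refine ⟨W.pullback f i x, ?_⟩
    rw [LinearMap.comp_apply, ← LinearMap.comp_apply (B i i), hBA i, LinearMap.id_apply]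

/-- **`Hⁱ(V) = f* Hⁱ(U) ⊕ Ker Pᵢ`** for the algebraic projector `P` of
`exists_algebraic_projector_onto_range_pullback` (an idempotent with image `f* Hⁱ(U)`; Kahn 2020
Lemma 6.30 (2)). [cite: Kahn2020, §6.9 Lemma 6.30 (2)] -/
theorem exists_algebraic_projector_isCompl (hV : IsSmoothProjective N V)
    (hU : IsSmoothProjective M U) (f : V ⟶ U) {ζ : W.obj V (2 * r)}
    (hζ : ζ ∈ W.ratAlgebraicClasses V r) {he : 2 * r + 2 * M = 2 * N} {hd : 0 + 2 * M = 2 * M}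
    (hne : W.pushforward (N := N) hU f he hd ζ ≠ 0) :
    ∃ P : W.GradedOp V V, W.IsAlgebraicGradedOp N N P ∧ (∀ i j : ℕ, i ≠ j → P i j = 0) ∧
      ∀ i : ℕ, IsCompl (LinearMap.range (W.pullback f i)) (LinearMap.ker (P i i)) := by
  obtain ⟨P, hPalg, hPd, hPP, hPf, hPr⟩ :=
    W.exists_algebraic_projector_onto_range_pullback hV hU f hζ hne
  refine ⟨P, hPalg, hPd, fun i ↦ LinearMap.IsProj.isCompl ⟨fun x ↦ ?_, ?_⟩⟩
  · rw [← hPr i]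
    exact LinearMap.mem_range_self _ x
  · rintro _ ⟨x, rfl⟩
    rw [← LinearMap.comp_apply, hPf i]

/-! ## The explicit decomposition `Hⁱ(V) = f* Hⁱ(U) ⊕ Ker f₊(· ∪ ζ)` -/

/-- **`Hⁱ(V) = f* Hⁱ(U) ⊕ Ker (x ↦ f₊ (x ∪ ζ))` for `U` dominated by `V`** (`f₊ ζ = q · 1`, `q ≠ 0`):
`q⁻¹ f* f₊ (· ∪ ζ)` is a projection of `Hⁱ(V)` onto `f* Hⁱ(U)` (`f₊ (f* x ∪ ζ) = q x`, projection
formula, Kahn 2020 §3.5.1) whose kernel is `Ker f₊ (· ∪ ζ)` (`f*` injective, Kleiman 1968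
Prop. 1.2.4). Degrees: `i + i' = 2M`, `i + 2r + i' = 2N`.
[cite: Kahn2020, §3.5.1 and §6.9 Lemma 6.30 (2)] [cite: Kleiman1968AlgebraicCycles, §1.2 Prop. 1.2.4] -/
theorem isCompl_range_pullback_ker_pushforward_cup (hV : IsSmoothProjective N V)
    (hU : IsSmoothProjective M U) (f : V ⟶ U) {ζ : W.obj V (2 * r)}
    (hζ : ζ ∈ W.ratAlgebraicClasses V r) {he : 2 * r + 2 * M = 2 * N} {hd : 0 + 2 * M = 2 * M}
    (hne : W.pushforward (N := N) hU f he hd ζ ≠ 0) {i i' : ℕ} (hi : i + i' = 2 * M)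
    (he' : i + 2 * r + i' = 2 * N) :
    IsCompl (LinearMap.range (W.pullback f i))
      (LinearMap.ker (W.pushforward (N := N) hU f he' hi ∘ₗ (W.cup (rfl : i + 2 * r = i + 2 * r)).flip ζ)) := by
  obtain ⟨q, hq⟩ := W.exists_pushforward_eq_ratCast_smul_one hV hU f hζ he hd
  have hq0 : (q : K) ≠ 0 := fun h ↦ hne (by rw [hq, h, zero_smul])
  set g := W.pushforward (N := N) hU f he' hi ∘ₗ (W.cup (rfl : i + 2 * r = i + 2 * r)).flip ζ
    with hg
  have hgf : ∀ x : W.obj U i, g (W.pullback f i x) = (q : K) • x := fun x ↦ by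
    rw [hg, LinearMap.comp_apply, LinearMap.flip_apply]
    exact W.pushforward_pullback_cup_eq_smul hV hU f hq hi he' x
  have hproj : LinearMap.IsProj (LinearMap.range (W.pullback f i))
      ((q : K)⁻¹ • (W.pullback f i ∘ₗ g)) := by
    refine ⟨fun x ↦ ?_, ?_⟩
    · rw [LinearMap.smul_apply, LinearMap.comp_apply]
      exact Submodule.smul_mem _ _ (LinearMap.mem_range_self _ _)
    · rintro _ ⟨x, rfl⟩
      rw [LinearMap.smul_apply, LinearMap.comp_apply, hgf, map_smul, smul_smul, inv_mul_cancel₀ hq0,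
        one_smul]
  have hker : LinearMap.ker ((q : K)⁻¹ • (W.pullback f i ∘ₗ g)) = LinearMap.ker g := by
    rw [LinearMap.ker_smul _ _ (inv_ne_zero hq0), LinearMap.ker_comp_of_ker_eq_bot _
      (LinearMap.ker_eq_bot.mpr (W.pullback_injective_of_pushforward_ne_zero hV hU f hζ hne i))]
  rw [← hker]
  exact hproj.isCompl

/-- **`bᵢ(V) = bᵢ(U) + dim Ker (x ↦ f₊ (x ∪ ζ))` for `U` dominated by `V`** (the decomposition
`Hⁱ(V) = f* Hⁱ(U) ⊕ Ker f₊(· ∪ ζ)` with `f*` injective). [cite: Kleiman1968AlgebraicCycles, §1.2 Prop. 1.2.4] -/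
theorem finrank_eq_finrank_add_finrank_ker_pushforward_cup (hV : IsSmoothProjective N V)
    (hU : IsSmoothProjective M U) (f : V ⟶ U) {ζ : W.obj V (2 * r)}
    (hζ : ζ ∈ W.ratAlgebraicClasses V r) {he : 2 * r + 2 * M = 2 * N} {hd : 0 + 2 * M = 2 * M}
    (hne : W.pushforward (N := N) hU f he hd ζ ≠ 0) {i i' : ℕ} (hi : i + i' = 2 * M)
    (he' : i + 2 * r + i' = 2 * N) :
    Module.finrank K (W.obj V i) = Module.finrank K (W.obj U i) +
      Module.finrank K (LinearMap.ker
        (W.pushforward (N := N) hU f he' hi ∘ₗ (W.cup (rfl : i + 2 * r = i + 2 * r)).flip ζ)) := by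
  haveI := W.finite_obj hV i
  rw [← Submodule.finrank_add_eq_of_isCompl
    (W.isCompl_range_pullback_ker_pushforward_cup hV hU f hζ hne hi he'),
    LinearMap.finrank_range_of_inj (W.pullback_injective_of_pushforward_ne_zero hV hU f hζ hne i)]

/-! ## The equidimensional case: `Hⁱ(V) = f* Hⁱ(U) ⊕ Ker f₊` -/

/-- **`Hⁱ(V) = f* Hⁱ(U) ⊕ Ker f₊` for `f : V ⟶ U` of non-zero degree** (`V`, `U` smooth projective
of the same dimension `N`, `f* ≠ 0` on `H²ᴺ(U)`, equivalently `f₊ 1 = deg f · 1 ≠ 0`): the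
projector `deg(f)⁻¹ f* f₊` (`f₊ f* = deg f`, Kahn 2020 §3.5.1; `f*` injective, Kleiman 1968
Prop. 1.2.4). Degrees: `i + i' = 2N`. [cite: Kahn2020, §3.5.1] [cite: Kleiman1968AlgebraicCycles, §1.2 Prop. 1.2.4] -/
theorem isCompl_range_pullback_ker_pushforward (hV : IsSmoothProjective N V)
    (hU : IsSmoothProjective N U) (f : V ⟶ U) (hf : W.pullback f (2 * N) ≠ 0) {i i' : ℕ}
    (hi : i + i' = 2 * N) :
    IsCompl (LinearMap.range (W.pullback f i))
      (LinearMap.ker (W.pushforward (N := N) hU f hi hi)) := by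
  have h0 : 0 + 2 * N = 2 * N := Nat.zero_add _
  obtain ⟨q, hq⟩ := W.exists_pushforward_one_eq_ratCast_smul hV hU f h0
  have hq0 : (q : K) ≠ 0 := by
    intro h
    rw [h, zero_smul, W.pushforward_one_eq_zero_iff hV hU f] at hq
    exact hf hq
  have hproj : LinearMap.IsProj (LinearMap.range (W.pullback f i))
      ((q : K)⁻¹ • (W.pullback f i ∘ₗ W.pushforward (N := N) hU f hi hi)) := by
    refine ⟨fun x ↦ ?_, ?_⟩
    · rw [LinearMap.smul_apply, LinearMap.comp_apply]
      exact Submodule.smul_mem _ _ (LinearMap.mem_range_self _ _)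
    · rintro _ ⟨x, rfl⟩
      rw [LinearMap.smul_apply, LinearMap.comp_apply, W.pushforward_pullback_eq_smul hV hU f h0 hq hi x,
        map_smul, smul_smul, inv_mul_cancel₀ hq0, one_smul]
  have hker : LinearMap.ker ((q : K)⁻¹ • (W.pullback f i ∘ₗ W.pushforward (N := N) hU f hi hi)) =
      LinearMap.ker (W.pushforward (N := N) hU f hi hi) := by
    rw [LinearMap.ker_smul _ _ (inv_ne_zero hq0), LinearMap.ker_comp_of_ker_eq_bot _
      (LinearMap.ker_eq_bot.mpr (W.pullback_injective_of_pullback_top_ne_zero hV hU f hf i))]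
  rw [← hker]
  exact hproj.isCompl

/-- **`bᵢ(V) = bᵢ(U) + dim Ker (f₊ : Hⁱ(V) → Hⁱ(U))` for `f : V ⟶ U` of non-zero degree**
(`Hⁱ(V) = f* Hⁱ(U) ⊕ Ker f₊`, `f*` injective). [cite: Kleiman1968AlgebraicCycles, §1.2 Prop. 1.2.4] -/
theorem finrank_eq_finrank_add_finrank_ker_pushforward (hV : IsSmoothProjective N V)
    (hU : IsSmoothProjective N U) (f : V ⟶ U) (hf : W.pullback f (2 * N) ≠ 0) {i i' : ℕ}
    (hi : i + i' = 2 * N) :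
    Module.finrank K (W.obj V i) = Module.finrank K (W.obj U i) +
      Module.finrank K (LinearMap.ker (W.pushforward (N := N) hU f hi hi)) := by
  haveI := W.finite_obj hV i
  rw [← Submodule.finrank_add_eq_of_isCompl (W.isCompl_range_pullback_ker_pushforward hV hU f hf hi),
    LinearMap.finrank_range_of_inj (W.pullback_injective_of_pullback_top_ne_zero hV hU f hf i)]

end WeilCohomology

end Literature.AlgebraicGeometry.Motives
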